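import Mathlib.ModelTheory.Algebra.Ring.Basic
import Mathlib.ModelTheory.Order
import Mathlib.ModelTheory.LanguageMap
import Mathlib.ModelTheory.Satisfiability
import Mathlib.Analysis.SpecialFunctions.Exp
import Mathlib.Analysis.Complex.Basic
import HarnessLib

-- provenance: harness21/H21/H21/Prelude/TranscendEllArithS/Languages.lean @ 04f08e6 (interim HEAD d8f2665); M5 mechanical rewrite
/-!
# First-order languages of ordered rings, exp-rings and ordered exp-rings

Trunk `TranscendEllArithS`, concept C5 (`exp_ring_language_structure`).

We set up the first-order languages in which the model theory of the real ordered field,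
the real exponential field `(ℝ, +, *, -, 0, 1, exp, ≤)` (Wilkie 1996; Macintyre–Wilkie 1996) and
the complex exponential field `(ℂ, +, *, -, 0, 1, exp)` (Zilber) are formulated:

* `Literature.ModelTheory.ExponentialFields.Language.orderedRing`  : functions `(+, *, -, 0, 1)` (Mathlib's `FirstOrder.ringFunc`),
  one binary relation `≤` (Mathlib's `FirstOrder.Language.orderRel`);
* `Literature.ModelTheory.ExponentialFields.Language.expRing`      : functions `(+, *, -, 0, 1, exp)` (`Literature.ModelTheory.ExponentialFields.expRingFunc`), no relations;
* `Literature.ModelTheory.ExponentialFields.Language.orderedExpRing` : functions `(+, *, -, 0, 1, exp)`, one binary relation `≤`.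

Following Mathlib's Presburger pattern (`FirstOrder.Language.presburger`,
`Mathlib/ModelTheory/Arithmetic/Presburger/Basic.lean`), every type carrying the notation classes
`Add, Mul, Neg, Zero, One, LE` (resp. a `Ring` with an `Literature.ModelTheory.ExponentialFields.ExponentialRing` structure) is
*globally* a structure for these languages, with all `funMap`/`RelMap` equations holding by `rfl`.
The exponential is supplied by the class `Literature.ExponentialRing R` (van den Dries' E-rings:
`exp 0 = 1`, `exp (x + y) = exp x * exp y`), with instances for `ℝ` (`Real.exp`) and `ℂ`
(`Complex.exp`).

We also record the language maps
`Language.ring →ᴸ Language.orderedRing ←ᴸ Language.order`,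
`Language.orderedRing →ᴸ Language.orderedExpRing ←ᴸ Language.expRing`
and the corresponding `LHom.IsExpansionOn` facts, and name the complete theories
`Literature.ModelTheory.ExponentialFields.realOrderedFieldTheory`, `Literature.ModelTheory.ExponentialFields.realExpTheory`, `Literature.ModelTheory.ExponentialFields.complexExpTheory`.

## Mathlib search

Mathlib has `FirstOrder.Language.ring` (with structures only through the class
`FirstOrder.Ring.CompatibleRing`; `compatibleRingOfRing` is a `def`), `FirstOrder.Language.order`
(`orderStructure` is a `def`), `Language.IsOrdered`, `Language.OrderedStructure`,
`Language.orderLHom`, `Language.completeTheory`, `Real.expMonoidHom`, `Complex.expMonoidHom`.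
It has no exponential-ring class and no (ordered) exp-ring language; there is no
`ExponentialRing`/`ExponentialField` anywhere.

## Design choices

* Namespace `Literature`; the languages live in the sub-namespace `Literature.Language`, *next to* the structure
  `FirstOrder.Language`. **Every file of this group writes `open FirstOrder` only, never
  `open FirstOrder.Language`**, so that `Language` = `FirstOrder.Language` and
  `Language.ring` = `FirstOrder.Language.ring`, `Language.order` = `FirstOrder.Language.order`
  stay unambiguous while `Language.orderedRing` etc. resolve to the `Literature` declarations.
* The alternative `Language.ring.sum Language.order` (Mathlib has `sum.instIsOrdered`) was rejected:
  a global structure instance on `ℝ` is needed either way and the sum language makes every `funMap`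
  a `Sum.elim`.
* Expansion facts for `ringHomOrderedRing : Language.ring →ᴸ Language.orderedRing` are stated under
  `[CompatibleRing M]` (Mathlib's only source of `Language.ring.Structure M`); on `ℝ` one uses
  `letI := FirstOrder.Ring.compatibleRingOfRing ℝ` inside proofs only. Similarly the expansion fact
  for `orderHomOrderedRing` is stated under `[Language.order.Structure M]
  [Language.order.OrderedStructure M]`.

## References

* D. Marker, *Model Theory: An Introduction*, §1.2 (languages and structures of (ordered) rings).
* L. van den Dries, *Exponential rings, exponential polynomials and exponential functions*,
  Pacific J. Math. 113 (1984).
* A. Wilkie, *Model completeness results for expansions of the ordered field of real numbers by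
  restricted Pfaffian functions and the exponential function*, JAMS 9 (1996).
* A. Macintyre, A. Wilkie, *On the decidability of the real exponential field* (1996).
-/

noncomputable section

open FirstOrder

namespace Literature.ModelTheory.ExponentialFields

/-! ### Exponential rings -/

/-- An *exponential ring* (E-ring, van den Dries 1984; Macintyre–Wilkie 1996 §1): a ring `R`
with a map `exp : R → R` that is a homomorphism from `(R, +, 0)` to `(R, *, 1)`, i.e.
`exp 0 = 1` and `exp (x + y) = exp x * exp y`. [cite: Dries1984] -/
class ExponentialRing (R : Type*) [Ring R] where
  /-- The exponential map of an exponential ring. -/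
  exp : R → R
  /-- `exp 0 = 1`. -/
  exp_zero : exp 0 = 1
  /-- `exp (x + y) = exp x * exp y`. -/
  exp_add : ∀ x y, exp (x + y) = exp x * exp y

attribute [simp] ExponentialRing.exp_zero

/-- The real exponential field `(ℝ, Real.exp)` is an exponential ring
(van den Dries 1984; Wilkie 1996). [cite: Dries1984] -/
instance Real.instExponentialRing : ExponentialRing ℝ where
  exp := Real.exp
  exp_zero := Real.exp_zero
  exp_add := Real.exp_add

/-- The complex exponential field `(ℂ, Complex.exp)` is an exponential ring
(van den Dries 1984; Zilber 2005). [cite: Dries1984] -/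
instance Complex.instExponentialRing : ExponentialRing ℂ where
  exp := Complex.exp
  exp_zero := Complex.exp_zero
  exp_add := Complex.exp_add

namespace ExponentialRing

variable {R : Type*} [Ring R] [ExponentialRing R]

/-- The E-ring exponential of `ℝ` is `Real.exp` (by definition). [folklore] -/
@[simp] theorem real_exp_eq : (exp : ℝ → ℝ) = Real.exp := rfl

/-- The E-ring exponential of `ℂ` is `Complex.exp` (by definition). [folklore] -/
@[simp] theorem complex_exp_eq : (exp : ℂ → ℂ) = Complex.exp := rfl

variable (R) in
/-- The exponential of an exponential ring as a monoid homomorphism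
`Multiplicative R →* R` (compare Mathlib's `Real.expMonoidHom`, `Complex.expMonoidHom`);
van den Dries 1984. [cite: Dries1984] -/
def expMonoidHom : Multiplicative R →* R where
  toFun x := exp x.toAdd
  map_one' := exp_zero
  map_mul' x y := exp_add x.toAdd y.toAdd

/-- Unfolding lemma for `expMonoidHom`. [folklore] -/
@[simp] theorem expMonoidHom_apply (x : Multiplicative R) : expMonoidHom R x = exp x.toAdd := rfl

/-- In an exponential ring, `exp x * exp (-x) = 1` (van den Dries 1984, (1.1)). [cite: Dries1984, (1.1] -/
theorem exp_mul_exp_neg (x : R) : exp x * exp (-x) = 1 := by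
  rw [← exp_add, add_neg_cancel, exp_zero]

/-- `exp x` is a unit in any exponential ring (van den Dries 1984, (1.1)). [cite: Dries1984, (1.1] -/
theorem isUnit_exp (x : R) : IsUnit (exp x) :=
  ⟨⟨exp x, exp (-x), exp_mul_exp_neg x, by simpa using exp_mul_exp_neg (-x)⟩, rfl⟩

end ExponentialRing

/-! ### The languages -/

/-- The function symbols of the language of exponential rings: `(+, *, -, 0, 1, exp)`
(Macintyre–Wilkie 1996; compare Mathlib's `FirstOrder.ringFunc`). [cite: MacintyreWilkie1996] -/
inductive expRingFunc : ℕ → Type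
  | add : expRingFunc 2
  | mul : expRingFunc 2
  | neg : expRingFunc 1
  | zero : expRingFunc 0
  | one : expRingFunc 0
  | exp : expRingFunc 1
  deriving DecidableEq

/-- The language of ordered rings `(+, *, -, 0, 1, ≤)` (Marker, *Model Theory* §1.2, Example 1.2.8):
Mathlib's ring function symbols `FirstOrder.ringFunc` together with Mathlib's order relation symbol
`FirstOrder.Language.orderRel`. Full name `Literature.ModelTheory.ExponentialFields.Language.orderedRing`. [folklore] -/
def Language.orderedRing : Language :=
  { Functions := ringFunc
    Relations := Language.orderRel }

/-- The language of exponential rings `(+, *, -, 0, 1, exp)` (Macintyre–Wilkie 1996; Zilber):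
function symbols `Literature.ModelTheory.ExponentialFields.expRingFunc`, no relation symbols. Full name `Literature.ModelTheory.ExponentialFields.Language.expRing`. [cite: MacintyreWilkie1996] -/
def Language.expRing : Language :=
  { Functions := expRingFunc
    Relations := fun _ => Empty }
  deriving Language.IsAlgebraic

/-- The language of ordered exponential rings `(+, *, -, 0, 1, exp, ≤)`, the language of the real
exponential field `ℝ_exp` (Wilkie 1996; Macintyre–Wilkie 1996). Full name
`Literature.ModelTheory.ExponentialFields.Language.orderedExpRing`. [cite: Wilkie1996] -/
def Language.orderedExpRing : Language :=
  { Functions := expRingFunc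
    Relations := Language.orderRel }

/-- `≤` is the order symbol of `Language.orderedRing` (Marker §1.2). [folklore] -/
instance Language.orderedRing.instIsOrdered : Language.orderedRing.IsOrdered := ⟨.le⟩

/-- `≤` is the order symbol of `Language.orderedExpRing` (Wilkie 1996). [cite: Wilkie1996] -/
instance Language.orderedExpRing.instIsOrdered : Language.orderedExpRing.IsOrdered := ⟨.le⟩

/-- The only binary relation symbol of `Language.orderedRing` is `leSymb`. [folklore] -/
theorem Language.orderedRing.relation_eq_leSymb (R : Language.orderedRing.Relations 2) :
    R = Language.leSymb := by
  cases R; rfl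

/-- The only binary relation symbol of `Language.orderedExpRing` is `leSymb`. [folklore] -/
theorem Language.orderedExpRing.relation_eq_leSymb (R : Language.orderedExpRing.Relations 2) :
    R = Language.leSymb := by
  cases R; rfl

/-! ### Structures (Presburger pattern) -/

section Structures

variable {M : Type*}

/-- Any type with `+, *, -, 0, 1, ≤` is a structure for the language of ordered rings, interpreting
each symbol by the corresponding notation class (Marker §1.2; compare Mathlib's
`FirstOrder.Ring.compatibleRingOfRing` and `Language.orderStructure`). [folklore] -/
instance Language.orderedRing.instStructure [Add M] [Mul M] [Neg M] [Zero M] [One M] [LE M] :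
    Language.orderedRing.Structure M where
  funMap
  | .add, v => v 0 + v 1
  | .mul, v => v 0 * v 1
  | .neg, v => -v 0
  | .zero, _ => 0
  | .one, _ => 1
  RelMap
  | .le, v => v 0 ≤ v 1

/-- Any exponential ring is a structure for the language of exponential rings
(Macintyre–Wilkie 1996). [cite: MacintyreWilkie1996] -/
instance Language.expRing.instStructure [Ring M] [ExponentialRing M] :
    Language.expRing.Structure M where
  funMap
  | .add, v => v 0 + v 1
  | .mul, v => v 0 * v 1
  | .neg, v => -v 0
  | .zero, _ => 0
  | .one, _ => 1
  | .exp, v => ExponentialRing.exp (v 0)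

/-- Any exponential ring with a `≤` is a structure for the language of ordered exponential rings
(Wilkie 1996; Macintyre–Wilkie 1996). [cite: Wilkie1996] -/
instance Language.orderedExpRing.instStructure [Ring M] [ExponentialRing M] [LE M] :
    Language.orderedExpRing.Structure M where
  funMap
  | .add, v => v 0 + v 1
  | .mul, v => v 0 * v 1
  | .neg, v => -v 0
  | .zero, _ => 0
  | .one, _ => 1
  | .exp, v => ExponentialRing.exp (v 0)
  RelMap
  | .le, v => v 0 ≤ v 1

namespace Language.orderedRing

variable [Add M] [Mul M] [Neg M] [Zero M] [One M] [LE M]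

/-- Interpretation of `+` in `Language.orderedRing` (by `rfl`). [folklore] -/
@[simp] theorem funMap_add (v : Fin 2 → M) :
    Language.Structure.funMap (L := Language.orderedRing) ringFunc.add v = v 0 + v 1 := rfl

/-- Interpretation of `*` in `Language.orderedRing` (by `rfl`). [folklore] -/
@[simp] theorem funMap_mul (v : Fin 2 → M) :
    Language.Structure.funMap (L := Language.orderedRing) ringFunc.mul v = v 0 * v 1 := rfl

/-- Interpretation of `-` in `Language.orderedRing` (by `rfl`). [folklore] -/
@[simp] theorem funMap_neg (v : Fin 1 → M) :
    Language.Structure.funMap (L := Language.orderedRing) ringFunc.neg v = -v 0 := rfl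

/-- Interpretation of `0` in `Language.orderedRing` (by `rfl`). [folklore] -/
@[simp] theorem funMap_zero (v : Fin 0 → M) :
    Language.Structure.funMap (L := Language.orderedRing) ringFunc.zero v = 0 := rfl

/-- Interpretation of `1` in `Language.orderedRing` (by `rfl`). [folklore] -/
@[simp] theorem funMap_one (v : Fin 0 → M) :
    Language.Structure.funMap (L := Language.orderedRing) ringFunc.one v = 1 := rfl

/-- Interpretation of `≤` in `Language.orderedRing` (by `rfl`). [folklore] -/
@[simp] theorem relMap_le (v : Fin 2 → M) :
    Language.Structure.RelMap (L := Language.orderedRing) Language.orderRel.le v ↔ v 0 ≤ v 1 :=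
  Iff.rfl

/-- The `Language.orderedRing`-structure on a type with `≤` is an ordered structure in Mathlib's
sense (`Language.OrderedStructure`). [folklore] -/
instance instOrderedStructure : Language.orderedRing.OrderedStructure M := ⟨fun _ => Iff.rfl⟩

end Language.orderedRing

namespace Language.expRing

variable [Ring M] [ExponentialRing M]

/-- Interpretation of `+` in `Language.expRing` (by `rfl`). [folklore] -/
@[simp] theorem funMap_add (v : Fin 2 → M) :
    Language.Structure.funMap (L := Language.expRing) expRingFunc.add v = v 0 + v 1 := rfl

/-- Interpretation of `*` in `Language.expRing` (by `rfl`). [folklore] -/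
@[simp] theorem funMap_mul (v : Fin 2 → M) :
    Language.Structure.funMap (L := Language.expRing) expRingFunc.mul v = v 0 * v 1 := rfl

/-- Interpretation of `-` in `Language.expRing` (by `rfl`). [folklore] -/
@[simp] theorem funMap_neg (v : Fin 1 → M) :
    Language.Structure.funMap (L := Language.expRing) expRingFunc.neg v = -v 0 := rfl

/-- Interpretation of `0` in `Language.expRing` (by `rfl`). [folklore] -/
@[simp] theorem funMap_zero (v : Fin 0 → M) :
    Language.Structure.funMap (L := Language.expRing) expRingFunc.zero v = 0 := rfl

/-- Interpretation of `1` in `Language.expRing` (by `rfl`). [folklore] -/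
@[simp] theorem funMap_one (v : Fin 0 → M) :
    Language.Structure.funMap (L := Language.expRing) expRingFunc.one v = 1 := rfl

/-- Interpretation of `exp` in `Language.expRing` (by `rfl`). [folklore] -/
@[simp] theorem funMap_exp (v : Fin 1 → M) :
    Language.Structure.funMap (L := Language.expRing) expRingFunc.exp v =
      ExponentialRing.exp (v 0) := rfl

end Language.expRing

namespace Language.orderedExpRing

variable [Ring M] [ExponentialRing M]

/-- Interpretation of `+` in `Language.orderedExpRing` (by `rfl`). [folklore] -/
@[simp] theorem funMap_add [LE M] (v : Fin 2 → M) :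
    Language.Structure.funMap (L := Language.orderedExpRing) expRingFunc.add v = v 0 + v 1 := rfl

/-- Interpretation of `*` in `Language.orderedExpRing` (by `rfl`). [folklore] -/
@[simp] theorem funMap_mul [LE M] (v : Fin 2 → M) :
    Language.Structure.funMap (L := Language.orderedExpRing) expRingFunc.mul v = v 0 * v 1 := rfl

/-- Interpretation of `-` in `Language.orderedExpRing` (by `rfl`). [folklore] -/
@[simp] theorem funMap_neg [LE M] (v : Fin 1 → M) :
    Language.Structure.funMap (L := Language.orderedExpRing) expRingFunc.neg v = -v 0 := rfl

/-- Interpretation of `0` in `Language.orderedExpRing` (by `rfl`). [folklore] -/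
@[simp] theorem funMap_zero [LE M] (v : Fin 0 → M) :
    Language.Structure.funMap (L := Language.orderedExpRing) expRingFunc.zero v = 0 := rfl

/-- Interpretation of `1` in `Language.orderedExpRing` (by `rfl`). [folklore] -/
@[simp] theorem funMap_one [LE M] (v : Fin 0 → M) :
    Language.Structure.funMap (L := Language.orderedExpRing) expRingFunc.one v = 1 := rfl

/-- Interpretation of `exp` in `Language.orderedExpRing` (by `rfl`). [folklore] -/
@[simp] theorem funMap_exp [LE M] (v : Fin 1 → M) :
    Language.Structure.funMap (L := Language.orderedExpRing) expRingFunc.exp v =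
      ExponentialRing.exp (v 0) := rfl

/-- Interpretation of `≤` in `Language.orderedExpRing` (by `rfl`). [folklore] -/
@[simp] theorem relMap_le [LE M] (v : Fin 2 → M) :
    Language.Structure.RelMap (L := Language.orderedExpRing) Language.orderRel.le v ↔ v 0 ≤ v 1 :=
  Iff.rfl

/-- The `Language.orderedExpRing`-structure on an exponential ring with `≤` is an ordered structure
in Mathlib's sense (`Language.OrderedStructure`). [folklore] -/
instance instOrderedStructure [LE M] : Language.orderedExpRing.OrderedStructure M :=
  ⟨fun _ => Iff.rfl⟩

end Language.orderedExpRing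

end Structures

/-! ### Terms -/

section Terms

variable {α : Type*} {M : Type*}

namespace Language.orderedRing

/-- The term operation `0` of `Language.orderedRing`
(compare `FirstOrder.Ring`'s term instances). [folklore] -/
instance (α : Type*) : Zero (Language.orderedRing.Term α) :=
  ⟨Language.Constants.term (ringFunc.zero : Language.orderedRing.Functions 0)⟩
/-- The term operation `1` of `Language.orderedRing`
(compare `FirstOrder.Ring`'s term instances). [folklore] -/
instance (α : Type*) : One (Language.orderedRing.Term α) :=
  ⟨Language.Constants.term (ringFunc.one : Language.orderedRing.Functions 0)⟩
/-- The term operation `+` of `Language.orderedRing`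
(compare `FirstOrder.Ring`'s term instances). [folklore] -/
instance (α : Type*) : Add (Language.orderedRing.Term α) :=
  ⟨Language.Functions.apply₂ (ringFunc.add : Language.orderedRing.Functions 2)⟩
/-- The term operation `*` of `Language.orderedRing`
(compare `FirstOrder.Ring`'s term instances). [folklore] -/
instance (α : Type*) : Mul (Language.orderedRing.Term α) :=
  ⟨Language.Functions.apply₂ (ringFunc.mul : Language.orderedRing.Functions 2)⟩
/-- The term operation `-` of `Language.orderedRing`
(compare `FirstOrder.Ring`'s term instances). [folklore] -/
instance (α : Type*) : Neg (Language.orderedRing.Term α) :=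
  ⟨Language.Functions.apply₁ (ringFunc.neg : Language.orderedRing.Functions 1)⟩

variable [Add M] [Mul M] [Neg M] [Zero M] [One M] [LE M] (v : α → M)

/-- Realization of `0` (by `rfl`; compare `FirstOrder.Ring.realize_zero`). [folklore] -/
@[simp] theorem realize_zero : (0 : Language.orderedRing.Term α).realize v = 0 := rfl

/-- Realization of `1` (by `rfl`; compare `FirstOrder.Ring.realize_one`). [folklore] -/
@[simp] theorem realize_one : (1 : Language.orderedRing.Term α).realize v = 1 := rfl

/-- Realization of `t₁ + t₂` (by `rfl`; compare `FirstOrder.Ring.realize_add`). [folklore] -/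
@[simp] theorem realize_add (t₁ t₂ : Language.orderedRing.Term α) :
    (t₁ + t₂).realize v = t₁.realize v + t₂.realize v := rfl

/-- Realization of `t₁ * t₂` (by `rfl`; compare `FirstOrder.Ring.realize_mul`). [folklore] -/
@[simp] theorem realize_mul (t₁ t₂ : Language.orderedRing.Term α) :
    (t₁ * t₂).realize v = t₁.realize v * t₂.realize v := rfl

/-- Realization of `-t` (by `rfl`; compare `FirstOrder.Ring.realize_neg`). [folklore] -/
@[simp] theorem realize_neg (t : Language.orderedRing.Term α) :
    (-t).realize v = -t.realize v := rfl

end Language.orderedRing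

namespace Language.expRing

/-- The term operation `0` of `Language.expRing`
(compare `FirstOrder.Ring`'s term instances). [folklore] -/
instance (α : Type*) : Zero (Language.expRing.Term α) :=
  ⟨Language.Constants.term (expRingFunc.zero : Language.expRing.Functions 0)⟩
/-- The term operation `1` of `Language.expRing`
(compare `FirstOrder.Ring`'s term instances). [folklore] -/
instance (α : Type*) : One (Language.expRing.Term α) :=
  ⟨Language.Constants.term (expRingFunc.one : Language.expRing.Functions 0)⟩
/-- The term operation `+` of `Language.expRing`
(compare `FirstOrder.Ring`'s term instances). [folklore] -/
instance (α : Type*) : Add (Language.expRing.Term α) :=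
  ⟨Language.Functions.apply₂ (expRingFunc.add : Language.expRing.Functions 2)⟩
/-- The term operation `*` of `Language.expRing`
(compare `FirstOrder.Ring`'s term instances). [folklore] -/
instance (α : Type*) : Mul (Language.expRing.Term α) :=
  ⟨Language.Functions.apply₂ (expRingFunc.mul : Language.expRing.Functions 2)⟩
/-- The term operation `-` of `Language.expRing`
(compare `FirstOrder.Ring`'s term instances). [folklore] -/
instance (α : Type*) : Neg (Language.expRing.Term α) :=
  ⟨Language.Functions.apply₁ (expRingFunc.neg : Language.expRing.Functions 1)⟩

/-- The term `exp t` of the language of exponential rings. [folklore] -/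
def termExp (t : Language.expRing.Term α) : Language.expRing.Term α :=
  Language.Functions.apply₁ (expRingFunc.exp : Language.expRing.Functions 1) t

variable [Ring M] [ExponentialRing M] (v : α → M)

/-- Realization of `0` (by `rfl`). [folklore] -/
@[simp] theorem realize_zero : (0 : Language.expRing.Term α).realize v = 0 := rfl

/-- Realization of `1` (by `rfl`). [folklore] -/
@[simp] theorem realize_one : (1 : Language.expRing.Term α).realize v = 1 := rfl

/-- Realization of `t₁ + t₂` (by `rfl`). [folklore] -/
@[simp] theorem realize_add (t₁ t₂ : Language.expRing.Term α) :
    (t₁ + t₂).realize v = t₁.realize v + t₂.realize v := rfl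

/-- Realization of `t₁ * t₂` (by `rfl`). [folklore] -/
@[simp] theorem realize_mul (t₁ t₂ : Language.expRing.Term α) :
    (t₁ * t₂).realize v = t₁.realize v * t₂.realize v := rfl

/-- Realization of `-t` (by `rfl`). [folklore] -/
@[simp] theorem realize_neg (t : Language.expRing.Term α) :
    (-t).realize v = -t.realize v := rfl

/-- Realization of `exp t` (by `rfl`). [folklore] -/
@[simp] theorem realize_exp (t : Language.expRing.Term α) :
    (termExp t).realize v = ExponentialRing.exp (t.realize v) := rfl

end Language.expRing

namespace Language.orderedExpRing

/-- The term operation `0` of `Language.orderedExpRing`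
(compare `FirstOrder.Ring`'s term instances). [folklore] -/
instance (α : Type*) : Zero (Language.orderedExpRing.Term α) :=
  ⟨Language.Constants.term (expRingFunc.zero : Language.orderedExpRing.Functions 0)⟩
/-- The term operation `1` of `Language.orderedExpRing`
(compare `FirstOrder.Ring`'s term instances). [folklore] -/
instance (α : Type*) : One (Language.orderedExpRing.Term α) :=
  ⟨Language.Constants.term (expRingFunc.one : Language.orderedExpRing.Functions 0)⟩
/-- The term operation `+` of `Language.orderedExpRing`
(compare `FirstOrder.Ring`'s term instances). [folklore] -/
instance (α : Type*) : Add (Language.orderedExpRing.Term α) :=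
  ⟨Language.Functions.apply₂ (expRingFunc.add : Language.orderedExpRing.Functions 2)⟩
/-- The term operation `*` of `Language.orderedExpRing`
(compare `FirstOrder.Ring`'s term instances). [folklore] -/
instance (α : Type*) : Mul (Language.orderedExpRing.Term α) :=
  ⟨Language.Functions.apply₂ (expRingFunc.mul : Language.orderedExpRing.Functions 2)⟩
/-- The term operation `-` of `Language.orderedExpRing`
(compare `FirstOrder.Ring`'s term instances). [folklore] -/
instance (α : Type*) : Neg (Language.orderedExpRing.Term α) :=
  ⟨Language.Functions.apply₁ (expRingFunc.neg : Language.orderedExpRing.Functions 1)⟩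

/-- The term `exp t` of the language of ordered exponential rings. [folklore] -/
def termExp (t : Language.orderedExpRing.Term α) : Language.orderedExpRing.Term α :=
  Language.Functions.apply₁ (expRingFunc.exp : Language.orderedExpRing.Functions 1) t

variable [Ring M] [ExponentialRing M] [LE M] (v : α → M)

/-- Realization of `0` (by `rfl`). [folklore] -/
@[simp] theorem realize_zero : (0 : Language.orderedExpRing.Term α).realize v = 0 := rfl

/-- Realization of `1` (by `rfl`). [folklore] -/
@[simp] theorem realize_one : (1 : Language.orderedExpRing.Term α).realize v = 1 := rfl

/-- Realization of `t₁ + t₂` (by `rfl`). [folklore] -/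
@[simp] theorem realize_add (t₁ t₂ : Language.orderedExpRing.Term α) :
    (t₁ + t₂).realize v = t₁.realize v + t₂.realize v := rfl

/-- Realization of `t₁ * t₂` (by `rfl`). [folklore] -/
@[simp] theorem realize_mul (t₁ t₂ : Language.orderedExpRing.Term α) :
    (t₁ * t₂).realize v = t₁.realize v * t₂.realize v := rfl

/-- Realization of `-t` (by `rfl`). [folklore] -/
@[simp] theorem realize_neg (t : Language.orderedExpRing.Term α) :
    (-t).realize v = -t.realize v := rfl

/-- Realization of `exp t` (by `rfl`). [folklore] -/
@[simp] theorem realize_exp (t : Language.orderedExpRing.Term α) :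
    (termExp t).realize v = ExponentialRing.exp (t.realize v) := rfl

end Language.orderedExpRing

end Terms

/-! ### Language maps and expansions -/

/-- The inclusion of ring function symbols into exp-ring function symbols. [folklore] -/
def expRingFunc.ofRingFunc : {n : ℕ} → ringFunc n → expRingFunc n
  | _, .add => .add
  | _, .mul => .mul
  | _, .neg => .neg
  | _, .zero => .zero
  | _, .one => .one

/-- `expRingFunc.ofRingFunc` is injective in each arity. [folklore] -/
theorem expRingFunc.ofRingFunc_injective (n : ℕ) :
    Function.Injective (expRingFunc.ofRingFunc (n := n)) := by
  intro f g h
  cases f <;> cases g <;> first | rfl | cases h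

/-- The inclusion of Mathlib's language of rings into the language of ordered rings
(forget nothing, add `≤`); Marker §1.2. [folklore] -/
def ringHomOrderedRing : Language.ring →ᴸ Language.orderedRing where
  onFunction _ f := f
  onRelation _ r := r.elim

/-- The inclusion of Mathlib's language of orders into the language of ordered rings: this is
Mathlib's `Language.orderLHom` for `Language.orderedRing`. [folklore] -/
abbrev orderHomOrderedRing : Language.order →ᴸ Language.orderedRing :=
  Language.orderedRing.orderLHom

/-- The inclusion of the language of ordered rings into the language of ordered exponential rings
(Wilkie 1996: `ℝ_exp` as an expansion of the ordered field `ℝ`). [cite: Wilkie1996, ℝ_exp  as an expansion of the ordered fi] -/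
def orderedRingHomOrderedExpRing : Language.orderedRing →ᴸ Language.orderedExpRing where
  onFunction _ f := expRingFunc.ofRingFunc f
  onRelation _ r := r

/-- The inclusion of the language of exponential rings into the language of ordered exponential
rings (add `≤`). [folklore] -/
def expRingHomOrderedExpRing : Language.expRing →ᴸ Language.orderedExpRing where
  onFunction _ f := f
  onRelation _ r := r.elim

/-- `ringHomOrderedRing` is injective. [folklore] -/
theorem ringHomOrderedRing_injective : ringHomOrderedRing.Injective :=
  ⟨fun h => h, fun {_} r => r.elim⟩

/-- `orderedRingHomOrderedExpRing` is injective. [folklore] -/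
theorem orderedRingHomOrderedExpRing_injective : orderedRingHomOrderedExpRing.Injective :=
  ⟨fun {n} => expRingFunc.ofRingFunc_injective n, fun h => h⟩

/-- `expRingHomOrderedExpRing` is injective. [folklore] -/
theorem expRingHomOrderedExpRing_injective : expRingHomOrderedExpRing.Injective :=
  ⟨fun h => h, fun {_} r => r.elim⟩

section Expansions

variable (M : Type*)

/-- On a `CompatibleRing` (Mathlib's compatibility class between `Language.ring.Structure M` and the
notation classes) with a `≤`, the ordered-ring structure expands the ring structure along
`ringHomOrderedRing`. On `ℝ` use `letI := FirstOrder.Ring.compatibleRingOfRing ℝ`. [folklore] -/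
instance ringHomOrderedRing.instIsExpansionOn [Add M] [Mul M] [Neg M] [Zero M] [One M] [LE M]
    [Ring.CompatibleRing M] : ringHomOrderedRing.IsExpansionOn M where
  map_onFunction f v := by
    cases f
    · exact (Ring.CompatibleRing.funMap_add v).symm
    · exact (Ring.CompatibleRing.funMap_mul v).symm
    · exact (Ring.CompatibleRing.funMap_neg v).symm
    · exact (Ring.CompatibleRing.funMap_zero v).symm
    · exact (Ring.CompatibleRing.funMap_one v).symm
  map_onRelation r := r.elim

/-- If `M` carries an ordered `Language.order`-structure (e.g. `Language.orderStructure M`), the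
ordered-ring structure expands it along `orderHomOrderedRing` (an instance of Mathlib's general
fact for `orderLHom`). [folklore] -/
instance orderHomOrderedRing.instIsExpansionOn [Add M] [Mul M] [Neg M] [Zero M] [One M] [LE M]
    [Language.order.Structure M] [Language.order.OrderedStructure M] :
    orderHomOrderedRing.IsExpansionOn M :=
  inferInstance

/-- The ordered exp-ring structure of an exponential ring with `≤` expands its ordered-ring
structure (all interpretations agree definitionally). [folklore] -/
instance orderedRingHomOrderedExpRing.instIsExpansionOn [Ring M] [ExponentialRing M] [LE M] :
    orderedRingHomOrderedExpRing.IsExpansionOn M where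
  map_onFunction f v := by cases f <;> rfl
  map_onRelation r v := by cases r; rfl

/-- The ordered exp-ring structure of an exponential ring with `≤` expands its exp-ring structure
(all interpretations agree definitionally). [folklore] -/
instance expRingHomOrderedExpRing.instIsExpansionOn [Ring M] [ExponentialRing M] [LE M] :
    expRingHomOrderedExpRing.IsExpansionOn M where
  map_onFunction f v := by cases f <;> rfl
  map_onRelation r := r.elim

end Expansions

/-! ### The complete theories of `ℝ`, `ℝ_exp` and `ℂ_exp` -/

/-- The complete first-order theory of the real ordered field in the language of ordered rings,
`Th(ℝ, +, *, -, 0, 1, ≤)` (Tarski; Marker §3.3). [folklore] -/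
def realOrderedFieldTheory : Language.orderedRing.Theory :=
  Language.orderedRing.completeTheory ℝ

/-- The complete first-order theory `T_exp = Th(ℝ, +, *, -, 0, 1, exp, ≤)` of the real exponential
field (Wilkie 1996; Macintyre–Wilkie 1996). [cite: Wilkie1996] -/
def realExpTheory : Language.orderedExpRing.Theory :=
  Language.orderedExpRing.completeTheory ℝ

/-- The complete first-order theory `Th(ℂ, +, *, -, 0, 1, exp)` of the complex exponential field
(Zilber 2005; Marker §1.2). [cite: Zilber2005] -/
def complexExpTheory : Language.expRing.Theory :=
  Language.expRing.completeTheory ℂ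

/-- `ℝ` is a model of `realOrderedFieldTheory` (tautologically). [folklore] -/
instance : ℝ ⊨ realOrderedFieldTheory :=
  Language.model_completeTheory

/-- `ℝ` is a model of `realExpTheory` (tautologically). [folklore] -/
instance : ℝ ⊨ realExpTheory :=
  Language.model_completeTheory

/-- `ℂ` is a model of `complexExpTheory` (tautologically). [folklore] -/
instance : ℂ ⊨ complexExpTheory :=
  Language.model_completeTheory

/-- `realOrderedFieldTheory` is complete (it is the complete theory of a structure). [folklore] -/
theorem realOrderedFieldTheory_isComplete : realOrderedFieldTheory.IsComplete :=
  Language.completeTheory.isComplete _ _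

/-- `realExpTheory` is complete (it is the complete theory of a structure). [folklore] -/
theorem realExpTheory_isComplete : realExpTheory.IsComplete :=
  Language.completeTheory.isComplete _ _

/-- `complexExpTheory` is complete (it is the complete theory of a structure). [folklore] -/
theorem complexExpTheory_isComplete : complexExpTheory.IsComplete :=
  Language.completeTheory.isComplete _ _

end Literature.ModelTheory.ExponentialFields
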